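import Literature.MathematicalPhysics.QuantumFieldTheory.Balaban1983to89.B1
import Literature.MathematicalPhysics.QuantumFieldTheory.Balaban1983to89.B4RuledReadings

/-!
# `Balaban1983to89.B1Prop21ZeroField` — T. Bałaban, *(Higgs)₂,₃ quantum fields in a finite volume. I. A lower bound*,
# Commun. Math. Phys. **85** (1982) 603–626 [Balaban1982Higgs1]: **Proposition 2.1** (2.23)–(2.26) pp. 610–611 AT ZERO
# FIELD — the MODEL-INSTANCE ledger of the row's decl of record `…B1.Prop21Printed` on the B4 cell's zero-field families
# (ruled Hölder range `0 ≤ α < 1` PROVED on the nested boxes; the literal typed leaf «α < 1» REFUTED), transported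
# through the kernel bridge `…B1.prop21Printed_iff_thmPrinted` (Prop. I.2.1 ≡ the Theorem p. 573 of
# [Balaban1983RegularityDecay]); theorems only

statement-level skeleton of published theorems with citation tags; proofs where landed; nothing here is a claim about the Yang–Mills mass gap

PDF held: `paper:balaban1982-cmp85-higgs23-i` (journal page = PDF page + 602), pp. 610–611 [PDF 8–9] (Prop. 2.1, read on the
×2 renders `run/shared/lean/pub/pub-balaban/b2b-balaban-ref1/pages/1982-cmp85-higgs23-I/1982-cmp85-higgs23-I-p008-x2.png`,
`…-p009-x2.png`); companion `paper:balaban1983-cmp89-regularity-decay` (journal page = PDF page + 570), p. 573 [PDF 3]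
(the Theorem *"(Proposition 2.1 of [1])"*).

CITATION HEADER (lean-in-tree rule).  Cell `lit-balaban` (HOME `run/shared/lean/pub/lit-balaban/`), Phase-2 proof seat
**p14** gen 8 (unit `lit-balaban-p14`); SKELETON row **B1.Prop2.1** (decl of record `…B1.Prop21Printed`, pub-balaban pv07,
`B1.lean` — UNCHANGED; status on arrival `typed-existing`, no model instance); kind «model instance + knitting»
(PHASE2-TARGETS §G.1/G.2(b)); fold owners r01/r14, referee ref-4.  EVERYTHING MATHEMATICAL BELOW IS AN EXISTING KERNEL
THEOREM OF THE TREE, USED BY NAME (never restated): the bridge `…B1.prop21Printed_iff_thmPrinted :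
B1.Prop21Printed fam ↔ B4.ThmPrinted fam` and `…B1.thmPrinted_of_prop21Uniform` (pv07), and the B4 sub-cell's zero-field
ledger of the Theorem p. 573 booked in `…B4RuledReadings` (template gen 28; referee ruling G-ref1-32): the ruled reading
`B4.ThmPrintedNN` (`0 ≤ α < 1`, bond-guarded carriers) PROVED on the nested-box family `B4Ineq111ZeroNestEta.nestFam`
(`thmPrintedNN_nestFam`, pv17 node 13), the literal leaf `B4.ThmPrinted` («∀ α < 1») REFUTED on the box families
`B4Ineq19ZeroBoxEta.boxFam`/`boxFamB` (node 16, the instance `α = −1`) and, with `ThmPrintedNN`, on b04's verbatim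
site-difference carrier `nestFamB` (node 17, the carrier defect), and over b04's own index `ZeroFieldInstance d`
(`ruling_thm573_allInstances`).

WHAT IS PRINTED (I pp. 610–611 [PDF 8–9], verbatim): *"**Proposition 2.1.** Let a set Ω satisfies Ω = B^k(Ω^{(k)}) and let
Ω^{(k)} ⊂ T₁^{(k)} be a sum of big blocks with M sufficiently large. Further, let a configuration A be regular on Ω in the
sense that |(∂^η_μA)(x)| ≦ c(e(L^kε))^{β−1}, x ∈ Ω, μ = 1, …, d, (2.23) […]. Then for e(L^kε) sufficiently small and α < 1
there exist positive constants δ₀, c₀, R₀ independent of A, k, Ω and depending on d, a, M only, c₀ on α also, such that for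
an arbitrary function f : Ω → R^N we have"* (2.24), (2.25) *"[…]. If Ω ⊂ Ω₀, then for δG_k(Ω, Ω₀, A) defined by the equality
δG_k(Ω, Ω₀, A) = G_k(Ω, A) − G_k(Ω₀, A), (2.26) we have the inequalities (2.24), (2.25) with the additional factor
exp(−δ₀ dist(supp f, Ωᶜ) − δ₀ dist({x, x′}, Ωᶜ)) on the right sides."*  B4 p. 573 [PDF 3]: *"**Theorem** (Proposition 2.1
of [1])"* with (1.9)–(1.12) = (2.24)–(2.26) clause for clause (pv07's kernel comparison `prop21Printed_iff_thmPrinted`,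
`ineq226_iff_ineq111_112`).  The case typed in the tree with a PROOF is `A = 0` (regularity (2.23) trivially met), `Ω ⊂ Ω₀`
nested boxes / boxes of the `η = L^{−k}`-lattice, every `k ≥ 1`, `L ≥ 2`, `a > 0`, mass window `[0, m²₊]`, big-block size
`Mb ≥ 1` (the B4 sub-cell's families).

WHAT THIS FILE PROVES (kernel-checked, zero `sorry`, NO new `def`, no new `Prop` fact; axioms standard):
* §1 (any family over `B4.EtaSetting`): `prop21Printed_clause_nn` (the typed leaf yields its `0 ≤ α < 1` clauses),
  **`prop21NN_iff_thmPrintedNN`** (the ruled reading of Prop. 2.1 — the typed leaf with the binder `0 ≤ α` inserted, written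
  out, no new name — is `B4.ThmPrintedNN`, clause for clause), `not_prop21Printed_iff` / `not_prop21Uniform_of_not_thmPrinted`
  (refutations transport through the bridge, and to the finer literal reading `Prop21Uniform`).
* §2 THE LEDGER OF ROW B1.Prop2.1 AT ZERO FIELD: **`prop21NN_nestFam`** / `prop21NN_nestFam_std` — the ruled reading of
  Prop. 2.1 HOLDS on the nested-box zero-field family (every admissible boundary assignment `g`, resp. b04's default
  `dist_η(supp f, Ω₀∖Ω)`); **`not_prop21Printed_boxFam`** / `not_prop21Printed_boxFamB` / `not_prop21Printed_nestFamB` /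
  `not_prop21Printed_zeroFieldSettingBond` / `not_prop21Printed_zeroFieldSettingB` — the literal typed leaf
  `B1.Prop21Printed` («∀ α < 1») FAILS on the B4 sub-cell's zero-field families (range defect `α = −1`, resp. carrier
  defect); `not_prop21Uniform_boxFam` / `not_prop21Uniform_nestFamB` — so does pv07's finer literal reading; the packaged
  ledger `ledger_prop21_nestFam` / `ledger_prop21_boxFam` and a non-vacuity `example` at `d + 1 = 4`.
HONEST SCOPE: nothing about `A ≠ 0` or general big-block regions (the B4 sub-cell proves the Theorem there only through
Lemma 2.1 / Cor. 2.3 so far); the row's decl `B1.Prop21Printed` is untouched; this file adds the B1-side names of the B4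
ledger so that row B1.Prop2.1 reads «proved (ruled reading 0 ≤ α < 1, A = 0 nested boxes) · refuted-as-typed (α < 0; A = 0
boxes)» exactly as row B4.Thm@573 does.  Unit `lit-balaban-p14` gen 8 (literature-prover-lit-balaban-p14-g8-0).
-/

namespace Literature.MathematicalPhysics.QuantumFieldTheory.Balaban1983to89.B1Prop21ZeroField

open Literature.MathematicalPhysics.QuantumFieldTheory.Balaban1983to89.B1 (Prop21Printed Prop21Uniform Ineq224_225
  Ineq226 prop21Printed_iff_thmPrinted thmPrinted_of_prop21Uniform ineq226_iff_ineq111_112)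
open Literature.MathematicalPhysics.QuantumFieldTheory.Balaban1983to89.B4 (EtaSetting ThmPrinted Ineq19_110 Ineq111_112)
open Literature.MathematicalPhysics.QuantumFieldTheory.Balaban1983to89.B4Ineq111ZeroNestEta (ThmPrintedNN NestInst nestFam
  nestFamB thmPrintedNN_nestFam bdist_admissible)
open Literature.MathematicalPhysics.QuantumFieldTheory.Balaban1983to89.B4Cor23ZeroEta (ZeroFieldInstance zeroFieldSettingB)
open Literature.MathematicalPhysics.QuantumFieldTheory.Balaban1983to89.B4Cor23ZeroDelta (bdist outR)
open Literature.MathematicalPhysics.QuantumFieldTheory.Balaban1983to89.B4Cor23Zero (supp)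
open Literature.MathematicalPhysics.QuantumFieldTheory.Balaban1983to89.B4Ineq19ZeroBoxEta (zeroFieldSettingBond BoxInst
  boxFam boxFamB)

/-! ## §1 The ruled reading of Proposition 2.1 over any family; refutations cross the bridge -/

section Generic

variable {I : Type}

/-- The typed leaf `B1.Prop21Printed` («for e(L^kε) sufficiently small and α < 1 there exist positive constants δ₀, c₀, R₀
…») yields in particular its clauses on the ruled Hölder range `0 ≤ α < 1`. [cite: Balaban1982Higgs1, Prop. 2.1
(2.23)–(2.26) pp.610–611; Hölder range 0 ≤ α < 1 per ruling G-ref1-32] -/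
theorem prop21Printed_clause_nn {fam : I → EtaSetting} (h : Prop21Printed fam) {α : ℝ} (_hα0 : 0 ≤ α)
    (hα1 : α < 1) :
    ∃ δ₀ c₀ R₀ e₁ : ℝ, 0 < δ₀ ∧ 0 < c₀ ∧ 0 < R₀ ∧ 0 < e₁ ∧ ∀ i : I,
      (fam i).regular → (fam i).bigBlocks → 0 < (fam i).e → (fam i).e ≤ e₁ →
        Ineq224_225 (fam i) α δ₀ c₀ R₀ ∧ Ineq226 (fam i) α δ₀ c₀ R₀ :=
  h α hα1

/-- **THE RULED READING OF PROPOSITION 2.1 IS B4's `ThmPrintedNN`, CLAUSE FOR CLAUSE**: Prop. 2.1 with the binder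
`0 ≤ α` inserted (written out over the typed displays `Ineq224_225`, `Ineq226`; no new name) ↔ the B4 sub-cell's ruled
leaf `B4.ThmPrintedNN` of the Theorem p. 573 — pv07's comparison `prop21Printed_iff_thmPrinted` restricted to the ruled
range ((2.26)-factor ↔ repaired (1.12)-factor by `ineq226_iff_ineq111_112`). [cite: Balaban1982Higgs1, Prop. 2.1
(2.23)–(2.26) pp.610–611; Hölder range 0 ≤ α < 1 per ruling G-ref1-32] -/
theorem prop21NN_iff_thmPrintedNN (fam : I → EtaSetting) :
    (∀ α : ℝ, 0 ≤ α → α < 1 → ∃ δ₀ c₀ R₀ e₁ : ℝ, 0 < δ₀ ∧ 0 < c₀ ∧ 0 < R₀ ∧ 0 < e₁ ∧ ∀ i : I,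
        (fam i).regular → (fam i).bigBlocks → 0 < (fam i).e → (fam i).e ≤ e₁ →
          Ineq224_225 (fam i) α δ₀ c₀ R₀ ∧ Ineq226 (fam i) α δ₀ c₀ R₀) ↔
      ThmPrintedNN fam := by
  simp only [ThmPrintedNN, Ineq224_225, ineq226_iff_ineq111_112]

/-- the typed leaf implies the ruled reading (a weakening, as `B4.ThmPrinted.nn`). [cite: Balaban1982Higgs1, Prop. 2.1
pp.610–611; Hölder range 0 ≤ α < 1 per ruling G-ref1-32] -/
theorem thmPrintedNN_of_prop21Printed {fam : I → EtaSetting} (h : Prop21Printed fam) : ThmPrintedNN fam :=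
  (prop21NN_iff_thmPrintedNN fam).1 fun _ hα0 hα1 => prop21Printed_clause_nn h hα0 hα1

/-- Refutations of the literal leaf cross pv07's bridge: `¬ B1.Prop21Printed fam ↔ ¬ B4.ThmPrinted fam`.
[cite: Balaban1982Higgs1, Prop. 2.1 pp.610–611] -/
theorem not_prop21Printed_iff (fam : I → EtaSetting) : ¬ Prop21Printed fam ↔ ¬ ThmPrinted fam :=
  not_congr (prop21Printed_iff_thmPrinted fam)

/-- … and reach pv07's finer literal reading `Prop21Uniform` (δ₀, R₀, e₁ before α), which implies the typed leaf.
[cite: Balaban1982Higgs1, Prop. 2.1 p.610] -/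
theorem not_prop21Uniform_of_not_thmPrinted (fam : I → EtaSetting) (h : ¬ ThmPrinted fam) : ¬ Prop21Uniform fam :=
  fun hu => h (thmPrinted_of_prop21Uniform fam hu)

end Generic

/-! ## §2 The ledger of row B1.Prop2.1 at zero field (the B4 sub-cell's families, by name) -/

section Ledger

variable {d ℓ : ℕ} {m2plus : ℝ}

/-- **PROPOSITION 2.1, RULED READING, HOLDS AT `A = 0` ON THE NESTED-BOX FAMILY `Ω ⊂ Ω₀`** (every `L = ℓ + 1 ≥ 2`, `a > 0`,
mass window `[0, m²₊]`, big-block size `Mb`, every ADMISSIBLE boundary assignment `0 ≤ g ≤ dist_η(supp f, Ω₀∖Ω)`; bond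
carrier of `D^η_A` per ruling G-ref1-32): for every `0 ≤ α < 1` there are `δ₀, c₀, R₀, e₁ > 0` with (2.24)–(2.26) for every
member — the B4 sub-cell's `thmPrintedNN_nestFam` read through `prop21NN_iff_thmPrintedNN`. [cite: Balaban1982Higgs1,
Prop. 2.1 (2.23)–(2.26) pp.610–611, case A = 0, Ω ⊂ Ω₀ nested boxes; carrier and range per ruling G-ref1-32] -/
theorem prop21NN_nestFam (hℓ : 1 ≤ ℓ) {a : ℝ} (ha : 0 < a) (Mb : ℕ)
    {g : ∀ i : ZeroFieldInstance d, (↥i.R → ℝ) → ℝ}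
    (hg : ∀ (i : ZeroFieldInstance d) (f : ↥i.R → ℝ),
      (outR i.R i.R₀).Nonempty → (supp f).Nonempty → g i f ≤ bdist i.n i.hsub f) :
    ∀ α : ℝ, 0 ≤ α → α < 1 → ∃ δ₀ c₀ R₀ e₁ : ℝ, 0 < δ₀ ∧ 0 < c₀ ∧ 0 < R₀ ∧ 0 < e₁ ∧ ∀ i : NestInst d ℓ m2plus,
      (nestFam ℓ m2plus a Mb g i).regular → (nestFam ℓ m2plus a Mb g i).bigBlocks →
        0 < (nestFam ℓ m2plus a Mb g i).e → (nestFam ℓ m2plus a Mb g i).e ≤ e₁ →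
          Ineq224_225 (nestFam ℓ m2plus a Mb g i) α δ₀ c₀ R₀ ∧ Ineq226 (nestFam ℓ m2plus a Mb g i) α δ₀ c₀ R₀ :=
  (prop21NN_iff_thmPrintedNN _).2 (thmPrintedNN_nestFam hℓ a ha Mb hg)

/-- the same with b04's default boundary assignment `g = dist_η(supp f, Ω₀∖Ω)` (admissible by `bdist_admissible`).
[cite: Balaban1982Higgs1, Prop. 2.1 (2.23)–(2.26) pp.610–611, case A = 0, Ω ⊂ Ω₀ nested boxes; carrier and range per
ruling G-ref1-32] -/
theorem prop21NN_nestFam_std (hℓ : 1 ≤ ℓ) {a : ℝ} (ha : 0 < a) (Mb : ℕ) :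
    ∀ α : ℝ, 0 ≤ α → α < 1 → ∃ δ₀ c₀ R₀ e₁ : ℝ, 0 < δ₀ ∧ 0 < c₀ ∧ 0 < R₀ ∧ 0 < e₁ ∧ ∀ i : NestInst d ℓ m2plus,
      (nestFam ℓ m2plus a Mb (fun i f => bdist i.n i.hsub f) i).regular →
        (nestFam ℓ m2plus a Mb (fun i f => bdist i.n i.hsub f) i).bigBlocks →
        0 < (nestFam ℓ m2plus a Mb (fun i f => bdist i.n i.hsub f) i).e →
        (nestFam ℓ m2plus a Mb (fun i f => bdist i.n i.hsub f) i).e ≤ e₁ →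
          Ineq224_225 (nestFam ℓ m2plus a Mb (fun i f => bdist i.n i.hsub f) i) α δ₀ c₀ R₀ ∧
            Ineq226 (nestFam ℓ m2plus a Mb (fun i f => bdist i.n i.hsub f) i) α δ₀ c₀ R₀ :=
  prop21NN_nestFam hℓ ha Mb bdist_admissible

/-- **THE LITERAL TYPED LEAF FAILS AT `A = 0` ON THE BOX FAMILY** (bond carrier): `¬ B1.Prop21Printed (boxFam …)` — the
instance `α = −1` of the literal binder «α < 1» (B4 node 16 `not_thmPrinted_boxFam` through the bridge).
[cite: Balaban1982Higgs1, Prop. 2.1 pp.610–611, case A = 0, Ω a box — kernel refutation of the literal range «α < 1»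
of the typed transcription; range per ruling G-ref1-32] -/
theorem not_prop21Printed_boxFam (hℓ : 1 ≤ ℓ) (hm2 : 0 ≤ m2plus) {a : ℝ} (ha : 0 < a) {Mb : ℕ} (hMb : 1 ≤ Mb)
    (g : ∀ i : ZeroFieldInstance d, (↥i.R → ℝ) → ℝ) : ¬ Prop21Printed (boxFam ℓ m2plus a Mb g) :=
  (not_prop21Printed_iff _).2 (B4.ruling_thm573_boxFam hℓ hm2 ha hMb g).2.1

/-- … and on b04's verbatim site-difference carrier of the boxes, `boxFamB`. [cite: Balaban1982Higgs1, Prop. 2.1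
pp.610–611, case A = 0, Ω a box — kernel refutation of the literal range «α < 1» of the typed transcription] -/
theorem not_prop21Printed_boxFamB (hℓ : 1 ≤ ℓ) (hm2 : 0 ≤ m2plus) {a : ℝ} (ha : 0 < a) {Mb : ℕ} (hMb : 1 ≤ Mb)
    (g : ∀ i : ZeroFieldInstance d, (↥i.R → ℝ) → ℝ) : ¬ Prop21Printed (boxFamB ℓ m2plus a Mb g) :=
  (not_prop21Printed_iff _).2 (B4.ruling_thm573_boxFam hℓ hm2 ha hMb g).2.2

/-- **… AND ON THE NESTED BOXES IN b04's VERBATIM CARRIER `nestFamB`** (the unguarded `δG`-Hölder field at an interior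
face of `Ω`: B4 node 17 `not_thmPrinted_nestFamB`), for every boundary assignment `g ≥ 0`. [cite: Balaban1982Higgs1,
Prop. 2.1 (2.26) pp.610–611, case A = 0, Ω ⊂ Ω₀ nested boxes — carrier per ruling G-ref1-32] -/
theorem not_prop21Printed_nestFamB (hℓ : 1 ≤ ℓ) (hm2 : 0 ≤ m2plus) {a : ℝ} (ha : 0 < a) {Mb : ℕ} (hMb : 1 ≤ Mb)
    {g : ∀ i : ZeroFieldInstance d, (↥i.R → ℝ) → ℝ} (hg0 : ∀ i f, 0 ≤ g i f) :
    ¬ Prop21Printed (nestFamB (d := d) ℓ m2plus a Mb g) :=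
  (not_prop21Printed_iff _).2 (B4Ineq112ZeroNestNegFace.not_thmPrinted_nestFamB hℓ hm2 ha hMb hg0)

/-- **… AND OVER b04's OWN INDEX OF ALL ZERO-FIELD INSTANCES `Ω ⊂ Ω₀`** (every `a > 0`, `Mb ≥ 1`, every `g`), in the bond
convention: `¬ B1.Prop21Printed (zeroFieldSettingBond a Mb g)` (B4 `ruling_thm573_allInstances`, range defect).
[cite: Balaban1982Higgs1, Prop. 2.1 pp.610–611, case A = 0 — kernel refutation of the literal range «α < 1» of the typed
transcription] -/
theorem not_prop21Printed_zeroFieldSettingBond {a : ℝ} (ha : 0 < a) {Mb : ℕ} (hMb : 1 ≤ Mb)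
    (g : ∀ i : ZeroFieldInstance d, (↥i.R → ℝ) → ℝ) :
    ¬ Prop21Printed (zeroFieldSettingBond a Mb g : ZeroFieldInstance d → EtaSetting) :=
  (not_prop21Printed_iff _).2 (B4Thm19ZeroBoxNegAlpha.not_thmPrinted_zeroFieldSettingBond ha hMb g)

/-- … and in b04's verbatim convention `zeroFieldSettingB a Mb g`. [cite: Balaban1982Higgs1, Prop. 2.1 pp.610–611, case
A = 0 — kernel refutation of the literal range «α < 1» of the typed transcription] -/
theorem not_prop21Printed_zeroFieldSettingB {a : ℝ} (ha : 0 < a) {Mb : ℕ} (hMb : 1 ≤ Mb)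
    (g : ∀ i : ZeroFieldInstance d, (↥i.R → ℝ) → ℝ) :
    ¬ Prop21Printed (zeroFieldSettingB a Mb g : ZeroFieldInstance d → EtaSetting) :=
  (not_prop21Printed_iff _).2 (B4Thm19ZeroBoxNegAlpha.not_thmPrinted_zeroFieldSettingB ha hMb g)

/-- pv07's finer literal reading `Prop21Uniform` («δ₀, R₀ depending on d, a, M only, c₀ on α also», still «α < 1»)
fails on the box family as well (it implies the typed leaf). [cite: Balaban1982Higgs1, Prop. 2.1 p.610, case A = 0, Ω a
box — kernel refutation of the literal range «α < 1»] -/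
theorem not_prop21Uniform_boxFam (hℓ : 1 ≤ ℓ) (hm2 : 0 ≤ m2plus) {a : ℝ} (ha : 0 < a) {Mb : ℕ} (hMb : 1 ≤ Mb)
    (g : ∀ i : ZeroFieldInstance d, (↥i.R → ℝ) → ℝ) : ¬ Prop21Uniform (boxFam ℓ m2plus a Mb g) :=
  not_prop21Uniform_of_not_thmPrinted _ (B4.ruling_thm573_boxFam hℓ hm2 ha hMb g).2.1

/-- … and on the nested boxes in the verbatim carrier. [cite: Balaban1982Higgs1, Prop. 2.1 p.610, case A = 0, Ω ⊂ Ω₀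
nested boxes — carrier per ruling G-ref1-32] -/
theorem not_prop21Uniform_nestFamB (hℓ : 1 ≤ ℓ) (hm2 : 0 ≤ m2plus) {a : ℝ} (ha : 0 < a) {Mb : ℕ} (hMb : 1 ≤ Mb)
    {g : ∀ i : ZeroFieldInstance d, (↥i.R → ℝ) → ℝ} (hg0 : ∀ i f, 0 ≤ g i f) :
    ¬ Prop21Uniform (nestFamB (d := d) ℓ m2plus a Mb g) :=
  not_prop21Uniform_of_not_thmPrinted _ (B4Ineq112ZeroNestNegFace.not_thmPrinted_nestFamB hℓ hm2 ha hMb hg0)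

/-- **THE LEDGER OF ROW B1.Prop2.1 ON THE NESTED-BOX ZERO-FIELD FAMILY** (`L ≥ 2`, `a > 0`, `m²₊ ≥ 0`, `Mb ≥ 1`, admissible
`0 ≤ g ≤ dist_η(supp f, Ω₀∖Ω)`): the ruled reading of Prop. 2.1 HOLDS on the bond carrier `nestFam` ∧ the literal typed leaf
`B1.Prop21Printed` and the finer `Prop21Uniform` FAIL on the verbatim carrier `nestFamB` — the B1-side spelling of
`B4.ruling_thm573_nestFam`. [cite: Balaban1982Higgs1, Prop. 2.1 (2.23)–(2.26) pp.610–611, case A = 0, Ω ⊂ Ω₀ nested boxes;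
carrier and range per ruling G-ref1-32] -/
theorem ledger_prop21_nestFam (hℓ : 1 ≤ ℓ) (hm2 : 0 ≤ m2plus) {a : ℝ} (ha : 0 < a) {Mb : ℕ} (hMb : 1 ≤ Mb)
    {g : ∀ i : ZeroFieldInstance d, (↥i.R → ℝ) → ℝ} (hg0 : ∀ i f, 0 ≤ g i f)
    (hg1 : ∀ (i : ZeroFieldInstance d) (f : ↥i.R → ℝ),
      (outR i.R i.R₀).Nonempty → (supp f).Nonempty → g i f ≤ bdist i.n i.hsub f) :
    ThmPrintedNN (nestFam (d := d) ℓ m2plus a Mb g) ∧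
      ¬ Prop21Printed (nestFamB (d := d) ℓ m2plus a Mb g) ∧ ¬ Prop21Uniform (nestFamB (d := d) ℓ m2plus a Mb g) :=
  ⟨thmPrintedNN_nestFam hℓ a ha Mb hg1, not_prop21Printed_nestFamB hℓ hm2 ha hMb hg0,
    not_prop21Uniform_nestFamB hℓ hm2 ha hMb hg0⟩

/-- **THE LEDGER OF ROW B1.Prop2.1 ON THE BOX FAMILY**: the ruled (2.24)–(2.25) half holds on the bond carrier (B4 node 12
`B4Ineq19ZeroBoxEta.ThmPrinted19NN`) ∧ the literal typed leaf fails in BOTH conventions. [cite: Balaban1982Higgs1,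
Prop. 2.1 (2.24)–(2.25) p.610, case A = 0, Ω a box; range per ruling G-ref1-32] -/
theorem ledger_prop21_boxFam (hℓ : 1 ≤ ℓ) (hm2 : 0 ≤ m2plus) {a : ℝ} (ha : 0 < a) {Mb : ℕ} (hMb : 1 ≤ Mb)
    (g : ∀ i : ZeroFieldInstance d, (↥i.R → ℝ) → ℝ) :
    B4Ineq19ZeroBoxEta.ThmPrinted19NN (boxFam ℓ m2plus a Mb g) ∧
      ¬ Prop21Printed (boxFam ℓ m2plus a Mb g) ∧ ¬ Prop21Printed (boxFamB ℓ m2plus a Mb g) :=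
  ⟨(B4.ruling_thm573_boxFam hℓ hm2 ha hMb g).1, not_prop21Printed_boxFam hℓ hm2 ha hMb g,
    not_prop21Printed_boxFamB hℓ hm2 ha hMb g⟩

/-- the ledger with b04's default boundary assignment. [cite: Balaban1982Higgs1, Prop. 2.1 (2.23)–(2.26) pp.610–611, case
A = 0, Ω ⊂ Ω₀ nested boxes; carrier and range per ruling G-ref1-32] -/
theorem ledger_prop21_nestFam_std (hℓ : 1 ≤ ℓ) (hm2 : 0 ≤ m2plus) {a : ℝ} (ha : 0 < a) {Mb : ℕ} (hMb : 1 ≤ Mb) :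
    ThmPrintedNN (nestFam (d := d) ℓ m2plus a Mb fun i f => bdist i.n i.hsub f) ∧
      ¬ Prop21Printed (nestFamB (d := d) ℓ m2plus a Mb fun i f => bdist i.n i.hsub f) ∧
      ¬ Prop21Uniform (nestFamB (d := d) ℓ m2plus a Mb fun i f => bdist i.n i.hsub f) :=
  ledger_prop21_nestFam hℓ hm2 ha hMb (fun i f => B4Ineq112ZeroNestNegFace.bdist_nonneg i f) bdist_admissible

end Ledger

/-! ## §3 Non-vacuity (`d + 1 = 4`, `L = 2`, `a = 1`, `m²₊ = 0`, `Mb = 1`) -/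

/-- the ledger of row B1.Prop2.1 is inhabited in four lattice dimensions: the ruled reading holds on `nestFam`, the literal
leaf and pv07's finer reading fail on `nestFamB`. -/
example : ThmPrintedNN (nestFam (d := 3) 1 0 1 1 fun i f => bdist i.n i.hsub f) ∧
    ¬ Prop21Printed (nestFamB (d := 3) 1 0 1 1 fun i f => bdist i.n i.hsub f) ∧
    ¬ Prop21Uniform (nestFamB (d := 3) 1 0 1 1 fun i f => bdist i.n i.hsub f) :=
  ledger_prop21_nestFam_std le_rfl le_rfl one_pos le_rfl

/-- … and the box ledger: the literal typed Prop. 2.1 fails in both conventions on the `d + 1 = 4` boxes. -/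
example : ¬ Prop21Printed (boxFam (d := 3) 1 0 1 1 fun _ _ => 0) ∧ ¬ Prop21Printed (boxFamB (d := 3) 1 0 1 1 fun _ _ => 0) :=
  ⟨not_prop21Printed_boxFam le_rfl le_rfl one_pos le_rfl _, not_prop21Printed_boxFamB le_rfl le_rfl one_pos le_rfl _⟩

end Literature.MathematicalPhysics.QuantumFieldTheory.Balaban1983to89.B1Prop21ZeroField
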